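import Mathlib
import Summits.Schanuel.Schanuel.Theorems.RigidCoreMinimalCounterexampleInAclLogSector
import Summits.Schanuel.Schanuel.Theorems.AclSubsetLogFreeCore.Negative.ExpAclField
import Summits.Schanuel.Schanuel.Theorems.RigidCoreMinimalCounterexampleInAclGlTwoReduction

/-!
# `GLₙ(ℤ)`-TRANSPORT OF FIRST FAILURES (EVERY RANK) — crux stmt-Schanuel-0969 `RigidCore.MinimalCounterexampleInAcl`

Line `kernel-arithmetic-selection`, stub `stub_glTransport` (every-rank change of coordinates
`y = A · x`, `A ∈ GLₙ(ℤ)`), `--supports stmt-Schanuel-0969`.  This is the rank-free version of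
`stub_glTwoReduction` (file `RigidCoreMinimalCounterexampleInAclGlTwoReduction`), with the explicit
Bézout matrix replaced by an integer matrix `A` with a two-sided integer inverse `B`
(`A * B = 1`, hence `B * A = 1` since square matrices over a commutative ring form a
Dedekind-finite monoid).

For `x : Fin n → ℂ` put `yᵢ = ∑ⱼ Aᵢⱼ xⱼ`.  Then `xⱼ = ∑ᵢ Bⱼᵢ yᵢ`, and

* `y` is ℚ-linearly independent iff `x` is (a relation `∑ gᵢ yᵢ = 0` is the relation
  `∑ⱼ (g A)ⱼ xⱼ = 0`, so `g A = 0` over `ℚ`, so `g = g A B = 0`);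
* the fields `ℚ(y, eʸ)` and `ℚ(x, eˣ)` COINCIDE as intermediate fields of `ℂ/ℚ`: the `yᵢ` are
  integer combinations of the `xⱼ` and the `e^{yᵢ} = ∏ⱼ (e^{xⱼ})^{Aᵢⱼ}` are integer Laurent
  monomials in the `e^{xⱼ}` (intermediate fields are closed under `zpow`), and conversely via `B`;
  in particular the transcendence degrees agree;
* `y ∈ acl(∅)ⁿ ⟹ x ∈ acl(∅)ⁿ`, since `acl^{ℂ_exp}(∅)` is a subring of `ℂ` containing `ℤ`.

Hence `A` transports rank-`n` first failures (`firstFailures n`: ℚ-linearly independent,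
`trdeg ℚ(x, eˣ) < n`, Schanuel below rank `n`) to rank-`n` first failures with the same field
`ℚ(x, eˣ)`, and pulls `acl`-membership back.  In the line this puts a first failure into
coordinates adapted to its mixed lattice (`stub_mixedFrame`).

## References

* [Lang1966] S. Lang, *Introduction to transcendental numbers*, Addison–Wesley 1966, Ch. II §1
  (invariance of `trdeg ℚ(x, eˣ)` under `GLₙ(ℤ)` acting on `x`; folklore bookkeeping around
  Schanuel's conjecture).
-/

noncomputable section

set_option linter.dupNamespace false

open Complex Set

namespace Summit.Schanuel.Schanuel.Cruxes.MinimalCounterexampleInAcl.KernelArithmeticSelection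

open Literature.NumberTheory.Transcendental (SchanuelRank)
open Summit.Schanuel.Schanuel.Theorems.AclSubsetLogFreeCore.Negative

variable {m n : ℕ}

/-! ## Integer combinations and their exponentials inside an intermediate field / `acl(∅)` -/

/-- An integer combination `∑ⱼ aⱼ xⱼ` of elements of an intermediate field lies in it.
[folklore] -/
theorem intSum_mem (K : IntermediateField ℚ ℂ) {x : Fin n → ℂ} (hx : ∀ j, x j ∈ K)
    (a : Fin n → ℤ) : ∑ j, (a j : ℂ) * x j ∈ K :=
  sum_mem fun j _ => mul_mem (intCast_mem K (a j)) (hx j)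

/-- `e^{∑ⱼ aⱼ xⱼ} = ∏ⱼ (e^{xⱼ})^{aⱼ}` for integers `aⱼ` (a Laurent monomial). [folklore] -/
theorem cexp_intSum (x : Fin n → ℂ) (a : Fin n → ℤ) :
    cexp (∑ j, (a j : ℂ) * x j) = ∏ j, cexp (x j) ^ a j := by
  rw [Complex.exp_sum]
  exact Finset.prod_congr rfl fun j _ => Complex.exp_int_mul (x j) (a j)

/-- If all `e^{xⱼ}` lie in an intermediate field then so does `e^{∑ⱼ aⱼ xⱼ}` for integers `aⱼ`
(intermediate fields are closed under integer powers). [folklore] -/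
theorem cexp_intSum_mem (K : IntermediateField ℚ ℂ) {x : Fin n → ℂ} (hx : ∀ j, cexp (x j) ∈ K)
    (a : Fin n → ℤ) : cexp (∑ j, (a j : ℂ) * x j) ∈ K := by
  rw [cexp_intSum]
  exact prod_mem fun j _ => zpow_mem (hx j) (a j)

/-- An integer combination of elements of `acl^{ℂ_exp}(∅)` lies in `acl^{ℂ_exp}(∅)` (a subfield of
`ℂ` containing `ℤ`). [folklore] -/
theorem intSum_mem_expAcl {x : Fin n → ℂ} (hx : ∀ j, x j ∈ expAcl) (a : Fin n → ℤ) :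
    ∑ j, (a j : ℂ) * x j ∈ expAcl :=
  mem_expAclField.mp (intSum_mem expAclField (fun j => mem_expAclField.mpr (hx j)) a)

/-- If `yᵢ = ∑ⱼ Aᵢⱼ xⱼ` for an integer matrix `A` then `ℚ(y, eʸ) ≤ ℚ(x, eˣ)`. [folklore] -/
theorem adjoin_le_of_intMat {x : Fin n → ℂ} {y : Fin m → ℂ} (A : Matrix (Fin m) (Fin n) ℤ)
    (hy : ∀ i, y i = ∑ j, (A i j : ℂ) * x j) :
    IntermediateField.adjoin ℚ (range y ∪ range (cexp ∘ y)) ≤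
      IntermediateField.adjoin ℚ (range x ∪ range (cexp ∘ x)) := by
  set K := IntermediateField.adjoin ℚ (range x ∪ range (cexp ∘ x))
  have hx : ∀ j, x j ∈ K := fun j => IntermediateField.subset_adjoin _ _ (Or.inl ⟨j, rfl⟩)
  have hex : ∀ j, cexp (x j) ∈ K := fun j => IntermediateField.subset_adjoin _ _ (Or.inr ⟨j, rfl⟩)
  have hyK : ∀ i, y i ∈ K ∧ cexp (y i) ∈ K := fun i => by
    rw [hy i]
    exact ⟨intSum_mem K hx (A i), cexp_intSum_mem K hex (A i)⟩
  rw [IntermediateField.adjoin_le_iff]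
  rintro _ (⟨i, rfl⟩ | ⟨i, rfl⟩)
  · exact (hyK i).1
  · exact (hyK i).2

/-! ## The change of coordinates `y = A · x`, `A ∈ GLₙ(ℤ)` -/

/-- Matrix form of `yᵢ = ∑ⱼ Aᵢⱼ xⱼ`: `y = A *ᵥ x` with `A` cast along `ℤ → R`. [folklore] -/
theorem eq_map_mulVec {R : Type*} [CommRing R] {x : Fin n → R} {y : Fin m → R}
    {A : Matrix (Fin m) (Fin n) ℤ} (hy : ∀ i, y i = ∑ j, (A i j : R) * x j) :
    y = (A.map (Int.castRingHom R)).mulVec x :=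
  funext hy

/-- Casting `A * B = 1` along `ℤ → R`. [folklore] -/
theorem map_mul_map_eq_one {R : Type*} [CommRing R] {A : Matrix (Fin m) (Fin n) ℤ}
    {B : Matrix (Fin n) (Fin m) ℤ} (h : A * B = 1) :
    A.map (Int.castRingHom R) * B.map (Int.castRingHom R) = 1 := by
  rw [← Matrix.map_mul, h, Matrix.map_one _ (map_zero _) (map_one _)]

/-- The inverse change of coordinates: if `A B = 1` (integer `n × n` matrices) and `y = A x` then
`x = B y`, i.e. `xᵢ = ∑ⱼ Bᵢⱼ yⱼ` (because also `B A = 1`). [folklore] -/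
theorem eq_intSum_of_mul_eq_one {R : Type*} [CommRing R] {x y : Fin n → R}
    {A B : Matrix (Fin n) (Fin n) ℤ} (hAB : A * B = 1)
    (hy : ∀ i, y i = ∑ j, (A i j : R) * x j) : ∀ i, x i = ∑ j, (B i j : R) * y j := by
  have hBA : B.map (Int.castRingHom R) * A.map (Int.castRingHom R) = 1 :=
    map_mul_map_eq_one (mul_eq_one_comm.mp hAB)
  have hx : x = (B.map (Int.castRingHom R)).mulVec y := by
    rw [eq_map_mulVec hy, Matrix.mulVec_mulVec, hBA, Matrix.one_mulVec]
  exact fun i => congrFun hx i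

/-- `GLₙ(ℤ)` preserves ℚ-linear independence: if `A B = 1`, `y = A x` and `x` is ℚ-linearly
independent then so is `y` (a relation `g` among the `yᵢ` gives the relation `g A` among the
`xⱼ`, so `g A = 0` and `g = g A B = 0`). [folklore] -/
theorem linearIndependent_of_mul_eq_one {x y : Fin n → ℂ} {A B : Matrix (Fin n) (Fin n) ℤ}
    (hAB : A * B = 1) (hy : ∀ i, y i = ∑ j, (A i j : ℂ) * x j) (hx : LinearIndependent ℚ x) :
    LinearIndependent ℚ y := by
  rw [Fintype.linearIndependent_iff] at hx ⊢
  intro g hg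
  -- the relation in the `x`-coordinates
  have hrel : ∑ j, (∑ i, g i * (A i j : ℚ)) • x j = 0 := by
    rw [← hg]
    simp only [Rat.smul_def, hy]
    push_cast
    simp only [Finset.sum_mul, Finset.mul_sum]
    rw [Finset.sum_comm]
    exact Finset.sum_congr rfl fun i _ => Finset.sum_congr rfl fun j _ => mul_assoc _ _ _
  -- i.e. `g ᵥ* A = 0` over `ℚ`; multiply by `B` on the right
  have hvec : Matrix.vecMul g (A.map (Int.castRingHom ℚ)) = 0 := funext fun j => hx _ hrel j
  have hg0 : g = 0 := by
    calc g = Matrix.vecMul g (A.map (Int.castRingHom ℚ) * B.map (Int.castRingHom ℚ)) := by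
          rw [map_mul_map_eq_one hAB, Matrix.vecMul_one]
      _ = 0 := by rw [← Matrix.vecMul_vecMul, hvec, Matrix.zero_vecMul]
  exact fun i => congrFun hg0 i

/-- `GLₙ(ℤ)` does not change the field `ℚ(x, eˣ)`: if `A B = 1` and `y = A x` then
`ℚ(y, eʸ) = ℚ(x, eˣ)` as intermediate fields of `ℂ/ℚ`. [folklore] -/
theorem adjoin_eq_of_mul_eq_one {x y : Fin n → ℂ} {A B : Matrix (Fin n) (Fin n) ℤ}
    (hAB : A * B = 1) (hy : ∀ i, y i = ∑ j, (A i j : ℂ) * x j) :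
    IntermediateField.adjoin ℚ (range y ∪ range (cexp ∘ y)) =
      IntermediateField.adjoin ℚ (range x ∪ range (cexp ∘ x)) :=
  le_antisymm (adjoin_le_of_intMat A hy) (adjoin_le_of_intMat B (eq_intSum_of_mul_eq_one hAB hy))

/-- `acl`-membership pulls back along `GLₙ(ℤ)`: if `A B = 1`, `y = A x` and all `yᵢ ∈ acl(∅)` then
all `xⱼ = ∑ᵢ Bⱼᵢ yᵢ ∈ acl(∅)`. [folklore] -/
theorem expAcl_of_mul_eq_one {x y : Fin n → ℂ} {A B : Matrix (Fin n) (Fin n) ℤ}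
    (hAB : A * B = 1) (hy : ∀ i, y i = ∑ j, (A i j : ℂ) * x j) (hacl : ∀ i, y i ∈ expAcl) :
    ∀ i, x i ∈ expAcl := fun i => by
  rw [eq_intSum_of_mul_eq_one hAB hy i]
  exact intSum_mem_expAcl hacl (B i)

/-- `GLₙ(ℤ)` transports first failures: if `A B = 1`, `y = A x` and `x ∈ firstFailures n` then
`y ∈ firstFailures n` (linear independence is preserved, the field `ℚ(x, eˣ)` is unchanged, and
the `SchanuelRank` hypotheses do not mention `x`). [folklore] -/
theorem firstFailures_of_mul_eq_one {x y : Fin n → ℂ} {A B : Matrix (Fin n) (Fin n) ℤ}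
    (hAB : A * B = 1) (hy : ∀ i, y i = ∑ j, (A i j : ℂ) * x j) (hx : x ∈ firstFailures n) :
    y ∈ firstFailures n :=
  ⟨linearIndependent_of_mul_eq_one hAB hy hx.1,
    trdeg_lt_of_eq (adjoin_eq_of_mul_eq_one hAB hy) hx.2.1, hx.2.2⟩

/-- **`GLₙ(ℤ)`-transport of first failures** (curried form: `y = A x`, `A B = 1`): `y` is again a
first failure, `ℚ(y, eʸ) = ℚ(x, eˣ)`, and `y ∈ acl(∅)ⁿ ⟹ x ∈ acl(∅)ⁿ`. [folklore] -/
theorem glTransport {x y : Fin n → ℂ} {A B : Matrix (Fin n) (Fin n) ℤ} (hAB : A * B = 1)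
    (hy : ∀ i, y i = ∑ j, (A i j : ℂ) * x j) (hx : x ∈ firstFailures n) :
    y ∈ firstFailures n ∧
      IntermediateField.adjoin ℚ (range y ∪ range (cexp ∘ y)) =
        IntermediateField.adjoin ℚ (range x ∪ range (cexp ∘ x)) ∧
      ((∀ i, y i ∈ expAcl) → ∀ i, x i ∈ expAcl) :=
  ⟨firstFailures_of_mul_eq_one hAB hy hx, adjoin_eq_of_mul_eq_one hAB hy,
    expAcl_of_mul_eq_one hAB hy⟩

/-- **Stub `stub_glTransport` (registered, PROVED): `GLₙ(ℤ)` acts on rank-`n` first failures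
preserving the field `ℚ(x, eˣ)` and pulling back `acl`-membership.**  For `x ∈ firstFailures n`
and integer matrices with `A B = 1`, the tuple `y = A x` (`yᵢ = ∑ⱼ Aᵢⱼ xⱼ`) is again a rank-`n`
first failure (ℚ-linear independence is preserved by the invertible integer matrix;
`ℚ(y, eʸ) = ℚ(x, eˣ)` since the `yᵢ` are integer combinations of the `xⱼ` and the `e^{yᵢ}` are
integer Laurent monomials in the `e^{xⱼ}`, and conversely via `B` because `B A = 1`; so the
transcendence degrees agree), and `y ∈ acl(∅)ⁿ ⟹ x ∈ acl(∅)ⁿ` (`xⱼ = ∑ᵢ Bⱼᵢ yᵢ`; `acl(∅)` is a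
subring containing `ℤ`). [folklore] -/
theorem stub_glTransport : ∀ (n : ℕ) (x : Fin n → ℂ) (A B : Matrix (Fin n) (Fin n) ℤ), A * B = 1 → x ∈ Summit.Schanuel.Schanuel.Cruxes.MinimalCounterexampleInAcl.KernelArithmeticSelection.firstFailures n → (fun i => ∑ j, (A i j : ℂ) * x j) ∈ Summit.Schanuel.Schanuel.Cruxes.MinimalCounterexampleInAcl.KernelArithmeticSelection.firstFailures n ∧ IntermediateField.adjoin ℚ (Set.range (fun i => ∑ j, (A i j : ℂ) * x j) ∪ Set.range (Complex.exp ∘ fun i => ∑ j, (A i j : ℂ) * x j)) = IntermediateField.adjoin ℚ (Set.range x ∪ Set.range (Complex.exp ∘ x)) ∧ ((∀ i, (∑ j, (A i j : ℂ) * x j) ∈ Summit.Schanuel.Schanuel.Theorems.AclSubsetLogFreeCore.Negative.expAcl) → ∀ i, x i ∈ Summit.Schanuel.Schanuel.Theorems.AclSubsetLogFreeCore.Negative.expAcl) := by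
  intro n x A B hAB hx
  exact glTransport hAB (fun _ => rfl) hx

end Summit.Schanuel.Schanuel.Cruxes.MinimalCounterexampleInAcl.KernelArithmeticSelection

end
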